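import Literature.Algebra.Polynomial.TouchardStirlingDobinski
import Mathlib.Tactic
import HarnessLib

/-!
# `S(n+1, k) = Σ_i C(n,i) S(i, k−1)` from `φ_{n+1} (x) = x (φ + 1)ⁿ` (Rota–Kahaner–Odlyzko §14)

G.-C. Rota, D. Kahaner, A. Odlyzko, *Finite operator calculus* (1973), §14, p. 749:

> The reader should convince himself that Stirling number identities can be inferred from identities
> relating the `φ_n (x)` and the `(x)_n`. We give a sampling, leaving the umbral proofs as exercises.
> (2) `φ_{n+1} (x) = x (φ (x) + 1)ⁿ` gives `S(n+1, k) = Σ_i C(n,i) S(i, k−1)`.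

The umbral identity (2) is the tree's `touchardPolynomial_succ_eq_X_mul_sum`
(`φ_{n+1} = x · Σ_i C(n,i) φ_i`, `BellTouchardPolynomials`, Robert Ch. IV §6.3), and `[xᵏ] φ_n = S(n,k)` is
`coeff_touchardPolynomial` (`TouchardStirlingDobinski`). Comparing coefficients of `xᵏ` gives the printed
recurrence for Mathlib's `Nat.stirlingSecond`, stated over `ℕ` (`stirlingSecond_succ_eq_sum_choose_mul`,
with `k − 1` written as `k ↦ k + 1`) — an identity not in Mathlib (which has the two-term recurrence
`Nat.stirlingSecond_succ_succ` only) nor elsewhere in the tree (the row-sum/Bell-number version is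
`Literature.Combinatorics.Enumerative.StirlingSecondKindEGF.stirlingSecondRowSum_succ`).

## References
* [RotaKahanerOdlyzko1973] G.-C. Rota, D. Kahaner, A. Odlyzko, *On the foundations of
  combinatorial theory VIII. Finite operator calculus*, J. Math. Anal. Appl. 42 (1973) 684–760,
  §14 (2), p. 749.
-/

open Polynomial Finset

namespace Literature.Algebra.Polynomial

/-- The coefficient identity behind (2), over a field of characteristic `0`:
`[x^{k+1}] φ_{n+1} = Σ_{i ≤ n} C(n,i) [xᵏ] φ_i`. [cite: RotaKahanerOdlyzko1973, §14 (2), p. 749] -/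
theorem coeff_touchardPolynomial_succ_succ (K : Type*) [Field K] [CharZero K] (n k : ℕ) :
    (touchardPolynomial K (n + 1)).coeff (k + 1) =
      ∑ i ∈ range (n + 1), (n.choose i : K) * (touchardPolynomial K i).coeff k := by
  rw [touchardPolynomial_succ_eq_X_mul_sum, coeff_X_mul, finsetSum_coeff]
  exact sum_congr rfl fun i _ => by rw [coeff_smul, smul_eq_mul]

/-- **`S(n+1, k+1) = Σ_{i=0}^{n} C(n,i) S(i, k)`** — "(2) `φ_{n+1} (x) = x (φ (x) + 1)ⁿ` gives
`S(n+1, k) = Σ_i C(n,i) S(i, k−1)`", for Mathlib's Stirling numbers of the second kind.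
[cite: RotaKahanerOdlyzko1973, §14 (2), p. 749] -/
theorem stirlingSecond_succ_eq_sum_choose_mul (n k : ℕ) :
    (n + 1).stirlingSecond (k + 1) = ∑ i ∈ range (n + 1), n.choose i * i.stirlingSecond k := by
  have h := coeff_touchardPolynomial_succ_succ ℚ n k
  simp only [coeff_touchardPolynomial] at h
  exact_mod_cast h

/-- The instance `k = 0`: `S(n+1, 1) = Σ_i C(n,i) S(i, 0) = 1` (only `i = 0` contributes) — a sanity check
of the indexing. [cite: RotaKahanerOdlyzko1973, §14 (2), p. 749] -/
theorem sum_choose_mul_stirlingSecond_zero (n : ℕ) :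
    ∑ i ∈ range (n + 1), n.choose i * i.stirlingSecond 0 = 1 := by
  rw [← stirlingSecond_succ_eq_sum_choose_mul, Nat.stirlingSecond_one_right]

end Literature.Algebra.Polynomial
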